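import Summits.SmoothPoincare4.SmoothPoincare4.Theses.CongruenceShadows

/-!
# SmoothPoincare4 / CongruenceShadows — `GateLogic` (support)

Settles item stmt-SmoothPoincare4-14597 of route CongruenceShadows:
`GateLogic : ShadowsStandard → ShadowApproximation → NormalFormStablyTrivial`
("the Artin split is sound").

Pure logic over `Literature/Topology/FourManifolds/GroupTrisections.lean`: for a
Waldhausen-normalised `(3+3m, m+1)` group trisection `K` of the trivial group, `ShadowsStandard`
supplies the standard shadows in every characteristic finite quotient, `ShadowApproximation` turns
them into an isomorphism `α` of kernel triples `N ≅ K` (`N = s4Kernels.stabilizeIter m`), and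
`K.IsStablyTrivial` holds with no stabilisation at all: `n = 0`, `m' = m`, the genus bookkeeping
`3 + 3m = (3 + 3m) + 3·0` is `rfl` (so the transport `TrisectionKernels.cast` is the identity and
`K.stabilizeIter 0 = K` definitionally), and the isomorphism `K ≅ N` is `α⁻¹`.
No named facts are used; the only import is the route file.
-/

-- the prescribed namespace `Summit.<P>.<Sub>.…` duplicates `SmoothPoincare4` (P = Sub)
set_option linter.dupNamespace false

namespace Summit.SmoothPoincare4.SmoothPoincare4.Theorems

open Summit.SmoothPoincare4.SmoothPoincare4.Theses.CongruenceShadows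
open Literature.Topology.FourManifolds

/-- Settles stmt-SmoothPoincare4-14597 (`GateLogic`, support of route CongruenceShadows):
`ShadowsStandard → ShadowApproximation → NormalFormStablyTrivial`.
Proof: given a normalised `(3+3m, m+1)` group trisection `K` of the trivial group, feed
`ShadowApproximation` with the standard shadows supplied by `ShadowsStandard` to get an
automorphism `α` of `S_(3+3m)` with `α(Nᵢ) = Kᵢ` (`N = s4Kernels.stabilizeIter m`); then
`K.IsStablyTrivial` with `n = 0`, `m' = m`, `h := rfl` and the automorphism `α⁻¹`, since
`α⁻¹(Kᵢ) = α⁻¹(α(Nᵢ)) = Nᵢ`. [folklore] -/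
theorem GateLogic_proof :
    Summit.SmoothPoincare4.SmoothPoincare4.Theses.CongruenceShadows.GateLogic := by
  unfold GateLogic
  intro hS hA m K hK hnorm
  obtain ⟨α, hα⟩ := hA m K hK hnorm (hS m K hK)
  refine ⟨0, m, rfl, α.symm, fun i => ?_⟩
  have hcomp : α.symm.toMonoidHom.comp α.toMonoidHom = MonoidHom.id _ :=
    MonoidHom.ext fun γ => by simp
  change (K i).map α.symm.toMonoidHom = s4Kernels.stabilizeIter m i
  rw [← hα i, Subgroup.map_map, hcomp, Subgroup.map_id]

end Summit.SmoothPoincare4.SmoothPoincare4.Theorems
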